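import Mathlib
import Literature.Probability.Percolation.DiagonalStripQKZUniqueness
import HarnessLib

/-!
# Uniqueness of the boundary qKZ solution for a general constant representation

Topic `Literature/Probability/Percolation`. `DiagonalStripQKZUniqueness` proves that the solutions of
IP12's exact system (20)–(22) on the *connectivity basis* (Temperley–Lieb generators acting by maps of
states) are proportional over the rapidity field. Here the same cocycle argument is run for an
**arbitrary family of constant matrices** `E_i` (`i = 1, …, 2m`) on a finite index type: every vector
`v` with `σ_i v = v ᵥ* Ř_i(z_i/z_{i+1})`, `Ř_i(u) = ([q/u]·1 - [u]·E_i)/[q u]`, and the two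
reflections with the same monomial twist is fixed by the cocycle matrix `Y` of the word
`σ_1 ⋯ σ_{2m} ι_L σ_{2m} ⋯ σ_1 ι_1` (**`solutionE_vecMul_cocycleYE`**); `Y` is an explicit product
(**`cocycleYE_eq_prodDE`**) whose first `2m` factors evaluate at `z_odd = 2`, `z_even = 2q²` to
`E_1, 1, E_3, 1, …`; so if the product `E_1 E_3 ⋯ E_{2m-1}` has rank one in the sense that
`x ᵥ* (E_1 E_3 ⋯) = ℓ(x) • w₀` for a fixed row `w₀`, the adjugate of `Y - 1` is not zero
(**`adjugate_cocycleYE_sub_one_ne_zero`**) and any two solutions are proportional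
(**`solutionsE_proportional`**). The vertex representation of the spin chain is the intended instance.

## References

* Y. Ikhlef, A. K. Ponsaing, *Finite-size left-passage probability in percolation*, J. Stat. Phys.
  149 (2012) 10–36, arXiv:1202.5476, §3.4 (20)–(22). [IkhlefPonsaing2012]
* P. Di Francesco, P. Zinn-Justin, *Quantum Knizhnik–Zamolodchikov equation: reflecting boundary
  conditions and combinatorics*, J. Stat. Mech. (2007) P12009, arXiv:0709.3410, §3.2. [DiFrancescoZinnJustin2007]
-/

noncomputable section

namespace Literature.Probability.Percolation

open Finset MvPolynomial Literature.Probability.LatticeModels Literature.Probability.LatticeModels.TemperleyLieb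

/-! ### Baxterised factors with a general generator matrix -/

section Factors

open _root_.Matrix

variable {α : Type*} [Fintype α] [DecidableEq α] {R S : Type*} [CommRing R] [CommRing S]

/-- The cleared Baxterised factor `q N D · Ř(N/D) = (q² D² - N²)·1 - q (N² - D²)·E`. [cite: IkhlefPonsaing2012, Def. 3.2] -/
def RpMatE (q N D : R) (E : Matrix α α R) : Matrix α α R :=
  (q ^ 2 * D ^ 2 - N ^ 2) • (1 : Matrix α α R) - (q * (N ^ 2 - D ^ 2)) • E

omit [Fintype α] in
/-- Ring homomorphisms map cleared factors to cleared factors. [folklore] -/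
theorem map_RpMatE (φ : R →+* S) (q N D : R) (E : Matrix α α R) :
    (RpMatE q N D E).map φ = RpMatE (φ q) (φ N) (φ D) (E.map φ) := by
  ext s s'
  simp only [RpMatE, Matrix.map_apply, Matrix.sub_apply, Matrix.smul_apply, Matrix.one_apply, smul_eq_mul, map_sub, map_mul,
    map_pow, mul_ite, mul_one, mul_zero]
  split_ifs <;> simp

variable {F F' : Type*} [Field F] [Field F']

/-- The Baxterised factor `Ř(N/D) = ([q D/N]·1 - [N/D]·E)/[q N/D]`. [cite: IkhlefPonsaing2012, Def. 3.2] -/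
def RfMatE (q N D : F) (E : Matrix α α F) : Matrix α α F := (q ^ 2 * N ^ 2 - D ^ 2)⁻¹ • RpMatE q N D E

omit [Fintype α] in
/-- Field homomorphisms map factors to factors. [folklore] -/
theorem map_RfMatE (φ : F →+* F') (q N D : F) (E : Matrix α α F) :
    (RfMatE q N D E).map φ = RfMatE (φ q) (φ N) (φ D) (E.map φ) := by
  have h : (RfMatE q N D E).map φ = (φ (q ^ 2 * N ^ 2 - D ^ 2)⁻¹) • (RpMatE q N D E).map φ := by
    ext s s'
    simp only [RfMatE, Matrix.map_apply, Matrix.smul_apply, smul_eq_mul, map_mul, map_inv₀]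
  rw [h, map_RpMatE, RfMatE]
  simp only [map_inv₀, map_sub, map_mul, map_pow]

omit [Fintype α] in
/-- The factor only depends on the ratio `N/D`. [folklore] -/
theorem RfMatE_scale (q : F) {t : F} (ht : t ≠ 0) (N D : F) (E : Matrix α α F) :
    RfMatE q (t * N) (t * D) E = RfMatE q N D E := by
  have ht2 : t ^ 2 ≠ 0 := pow_ne_zero 2 ht
  rw [RfMatE, RfMatE, RpMatE, RpMatE]
  have e1 : q ^ 2 * (t * N) ^ 2 - (t * D) ^ 2 = t ^ 2 * (q ^ 2 * N ^ 2 - D ^ 2) := by ring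
  have e2 : q ^ 2 * (t * D) ^ 2 - (t * N) ^ 2 = t ^ 2 * (q ^ 2 * D ^ 2 - N ^ 2) := by ring
  have e3 : q * ((t * N) ^ 2 - (t * D) ^ 2) = t ^ 2 * (q * (N ^ 2 - D ^ 2)) := by ring
  rw [e1, e2, e3, mul_smul, mul_smul, ← smul_sub, smul_smul,
    show (t ^ 2 * (q ^ 2 * N ^ 2 - D ^ 2))⁻¹ * t ^ 2 = (q ^ 2 * N ^ 2 - D ^ 2)⁻¹ from by
      rw [_root_.mul_inv_rev, mul_assoc, inv_mul_cancel₀ ht2, mul_one]]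

/-- Entries of a row vector times a factor. [folklore] -/
theorem vecMul_RfMatE_apply (x : α → F) (q N D : F) (E : Matrix α α F) (s : α) :
    (x ᵥ* RfMatE q N D E) s = (q ^ 2 * N ^ 2 - D ^ 2)⁻¹ * ((q ^ 2 * D ^ 2 - N ^ 2) * x s - q * (N ^ 2 - D ^ 2) * (x ᵥ* E) s) := by
  rw [RfMatE, RpMatE, vecMul_smul, Pi.smul_apply, smul_eq_mul, vecMul_sub, vecMul_smul, vecMul_smul, vecMul_one, Pi.sub_apply,
    Pi.smul_apply, Pi.smul_apply, smul_eq_mul, smul_eq_mul]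

end Factors

/-! ### The exchange relation in matrix form -/

section ExchangeForm

open _root_.Matrix

variable {α : Type*} [Fintype α] [DecidableEq α]

/-- The constant generator matrices over the rapidity field. [folklore] -/
def eMat (Ec : ℕ → Matrix α α ℂ) (i : ℕ) : Matrix α α (RapidityField ℂ) := (Ec i).map (genC ℂ)

/-- The Baxterised factor at level `i`. [cite: IkhlefPonsaing2012, Def. 3.2] -/
def eR (Ec : ℕ → Matrix α α ℂ) (q : ℂ) (i : ℕ) (N D : RapidityField ℂ) : Matrix α α (RapidityField ℂ) :=
  RfMatE (genC ℂ q) N D (eMat Ec i)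

omit [Fintype α] in
/-- Endomorphisms fixing the constants transport the factors. [folklore] -/
theorem map_eR {Ec : ℕ → Matrix α α ℂ} {φ : RapidityField ℂ →+* RapidityField ℂ} (hφ : ∀ a, φ (genC ℂ a) = genC ℂ a)
    (q : ℂ) (i : ℕ) (N D : RapidityField ℂ) : (eR Ec q i N D).map φ = eR Ec q i (φ N) (φ D) := by
  rw [eR, map_RfMatE, hφ, eR]
  congr 1
  ext s s'
  simp [eMat, hφ]

/-- **From the exact exchange relation to the matrix form**: if
`[q z_{i+1}/z_i] v - [z_i/z_{i+1}] (v ᵥ* E_i) = [q z_i/z_{i+1}] σ_i v` componentwise then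
`σ_i v = v ᵥ* Ř_i(z_i/z_{i+1})`. [cite: IkhlefPonsaing2012, §3.4 (20)] -/
theorem exchangeE_matrix_of {q : ℂ} (hq : q ^ 2 + q + 1 = 0) {Ec : ℕ → Matrix α α ℂ} {i : ℕ} {v : α → RapidityField ℂ}
    (hex : ∀ s, qbr (genC ℂ q * genZ ℂ (i + 1) / genZ ℂ i) * v s - qbr (genZ ℂ i / genZ ℂ (i + 1)) * (v ᵥ* eMat Ec i) s =
      qbr (genC ℂ q * genZ ℂ i / genZ ℂ (i + 1)) * genSwap ℂ i (v s)) (s : α) :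
    genSwap ℂ i (v s) = (v ᵥ* eR Ec q i (genZ ℂ i) (genZ ℂ (i + 1))) s := by
  have hq0 : q ≠ 0 := ne_zero_of_quad hq
  have hzi := genZ_ne_zero (K₀ := ℂ) i
  have hzj := genZ_ne_zero (K₀ := ℂ) (i + 1)
  have hC : genC ℂ q ^ 2 * genZ ℂ i ^ 2 - genZ ℂ (i + 1) ^ 2 ≠ 0 := by
    have : genC ℂ q ^ 2 * genZ ℂ i ^ 2 - genZ ℂ (i + 1) ^ 2 = toRF ℂ (C (q ^ 2) * X i ^ 2 - X (i + 1) ^ 2) := by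
      simp only [map_sub, map_mul, map_pow]; rfl
    rw [this]
    refine toRF_ne_zero_of_eval (fun n => if n = i then 1 else 0) ?_
    simp [hq0]
  have h := hex s
  have h' := congrArg (· * (genC ℂ q * genZ ℂ i * genZ ℂ (i + 1))) h
  simp only [sub_mul] at h'
  rw [mul_right_comm, qbr_mul_clear₁ hq0, mul_right_comm, qbr_mul_clear₂, mul_right_comm, qbr_mul_clear₃ hq0] at h'
  have e1 : toRF ℂ (C (q ^ 2) * X (i + 1) ^ 2 - X i ^ 2) = genC ℂ q ^ 2 * genZ ℂ (i + 1) ^ 2 - genZ ℂ i ^ 2 := by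
    simp only [map_sub, map_mul, map_pow]; rfl
  have e2 : toRF ℂ (C q * (X i ^ 2 - X (i + 1) ^ 2)) = genC ℂ q * (genZ ℂ i ^ 2 - genZ ℂ (i + 1) ^ 2) := by
    simp only [map_sub, map_mul, map_pow]; rfl
  have e3 : toRF ℂ (C (q ^ 2) * X i ^ 2 - X (i + 1) ^ 2) = genC ℂ q ^ 2 * genZ ℂ i ^ 2 - genZ ℂ (i + 1) ^ 2 := by
    simp only [map_sub, map_mul, map_pow]; rfl
  rw [e1, e2, e3] at h'
  rw [eR, vecMul_RfMatE_apply, h', ← mul_assoc, inv_mul_cancel₀ hC, one_mul]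

end ExchangeForm

/-! ### The cocycle -/

section Cocycle

open _root_.Matrix

variable {α : Type*} [Fintype α] [DecidableEq α] {Ec : ℕ → Matrix α α ℂ} {m : ℕ}

/-- The relation "`φ v = t · (v ᵥ* B)`". [folklore] -/
def CocRelE (v : α → RapidityField ℂ) (φ : RapidityField ℂ →+* RapidityField ℂ) (B : Matrix α α (RapidityField ℂ))
    (t : RapidityField ℂ) : Prop :=
  ∀ s, φ (v s) = t * (v ᵥ* B) s

/-- Base of the cocycle: the bottom reflection. [cite: IkhlefPonsaing2012, (22)] -/
theorem cocRelE_base {v : α → RapidityField ℂ} {a : ℤ} (hbot : ∀ s, genInv ℂ 1 (v s) = genZ ℂ 1 ^ (2 * a) * v s) :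
    CocRelE v (genInv ℂ 1) 1 (genZ ℂ 1 ^ (2 * a)) := by
  intro s; rw [vecMul_one]; exact hbot s

/-- Swap step of the cocycle. [cite: IkhlefPonsaing2012, (20)] -/
theorem cocRelE_swap {q : ℂ} {v : α → RapidityField ℂ} {φ : RapidityField ℂ →+* RapidityField ℂ}
    {B : Matrix α α (RapidityField ℂ)} {t : RapidityField ℂ} (h : CocRelE v φ B t) {k : ℕ}
    (hexk : ∀ s, genSwap ℂ k (v s) = (v ᵥ* eR Ec q k (genZ ℂ k) (genZ ℂ (k + 1))) s) :
    CocRelE v ((genSwap ℂ k).toRingHom.comp φ) (eR Ec q k (genZ ℂ k) (genZ ℂ (k + 1)) * B.map (genSwap ℂ k)) (genSwap ℂ k t) := by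
  intro s
  rw [RingHom.comp_apply, RingEquiv.toRingHom_eq_coe, RingHom.coe_coe, h s, map_mul, ← Matrix.vecMul_vecMul]
  congr 1
  rw [vecMul, dotProduct, map_sum, vecMul, dotProduct]
  refine Finset.sum_congr rfl fun s' _ => ?_
  rw [map_mul, hexk s', Matrix.map_apply]

omit [DecidableEq α] in
/-- Inversion step of the cocycle. [cite: IkhlefPonsaing2012, (21)] -/
theorem cocRelE_inv {v : α → RapidityField ℂ} {φ : RapidityField ℂ →+* RapidityField ℂ} {B : Matrix α α (RapidityField ℂ)}
    {t : RapidityField ℂ} (h : CocRelE v φ B t) {L : ℕ} {a : ℤ} (htop : ∀ s, genInv ℂ L (v s) = genZ ℂ L ^ (2 * a) * v s) :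
    CocRelE v ((genInv ℂ L).comp φ) (B.map (genInv ℂ L)) (genZ ℂ L ^ (2 * a) * genInv ℂ L t) := by
  intro s
  rw [RingHom.comp_apply, h s, map_mul, vecMul, dotProduct, map_sum, vecMul, dotProduct, Finset.mul_sum, Finset.mul_sum]
  refine Finset.sum_congr rfl fun s' _ => ?_
  rw [map_mul, htop s', Matrix.map_apply]
  ring

variable (Ec)

/-- The matrix after the up phase. [folklore] -/
def upBE (m : ℕ) (q : ℂ) : ℕ → Matrix α α (RapidityField ℂ)
  | 0 => 1
  | k + 1 => eR Ec q (k + 1) (genZ ℂ (k + 1)) (genZ ℂ (k + 2)) * (upBE m q k).map (genSwap ℂ (k + 1))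

/-- The matrix after the down phase. [folklore] -/
def downBE (m : ℕ) (q : ℂ) : ℕ → Matrix α α (RapidityField ℂ)
  | 0 => (upBE Ec m q (2 * m)).map (genInv ℂ (2 * m + 1))
  | j + 1 => eR Ec q (2 * m - j) (genZ ℂ (2 * m - j)) (genZ ℂ (2 * m - j + 1)) * (downBE m q j).map (genSwap ℂ (2 * m - j))

/-- **The cocycle matrix** of the word `σ_1 ⋯ σ_{2m} ι_L σ_{2m} ⋯ σ_1 ι_1`. [cite: IkhlefPonsaing2012, §3.4] -/
def cocycleYE (m : ℕ) (q : ℂ) : Matrix α α (RapidityField ℂ) := downBE Ec m q (2 * m)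

variable {Ec} {q : ℂ} {v : α → RapidityField ℂ} {a : ℤ}

/-- The up phase. [cite: IkhlefPonsaing2012, (20)–(22)] -/
theorem cocRelE_up (hex : ∀ i, 1 ≤ i → i ≤ 2 * m → ∀ s, genSwap ℂ i (v s) = (v ᵥ* eR Ec q i (genZ ℂ i) (genZ ℂ (i + 1))) s)
    (hbot : ∀ s, genInv ℂ 1 (v s) = genZ ℂ 1 ^ (2 * a) * v s) {k : ℕ} (hk : k ≤ 2 * m) :
    CocRelE v (upHom k) (upBE Ec m q k) (genZ ℂ (k + 1) ^ (2 * a)) := by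
  induction k with
  | zero => exact cocRelE_base hbot
  | succ k ih =>
    have h := cocRelE_swap (ih (by omega)) (hex (k + 1) (by omega) (by omega))
    have ht : genSwap ℂ (k + 1) (genZ ℂ (k + 1) ^ (2 * a)) = genZ ℂ (k + 1 + 1) ^ (2 * a) := by
      rw [map_zpow₀, genSwap_genZ_eq, if_pos rfl]
    rw [ht] at h
    exact h

/-- The inversion at the top. [cite: IkhlefPonsaing2012, (20)–(22)] -/
theorem cocRelE_mid (hex : ∀ i, 1 ≤ i → i ≤ 2 * m → ∀ s, genSwap ℂ i (v s) = (v ᵥ* eR Ec q i (genZ ℂ i) (genZ ℂ (i + 1))) s)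
    (hbot : ∀ s, genInv ℂ 1 (v s) = genZ ℂ 1 ^ (2 * a) * v s)
    (htop : ∀ s, genInv ℂ (2 * m + 1) (v s) = genZ ℂ (2 * m + 1) ^ (2 * a) * v s) :
    CocRelE v (downHom m 0) (downBE Ec m q 0) 1 := by
  have h := cocRelE_inv (cocRelE_up hex hbot le_rfl) htop
  have ht : genZ ℂ (2 * m + 1) ^ (2 * a) * genInv ℂ (2 * m + 1) (genZ ℂ (2 * m + 1) ^ (2 * a)) = 1 := by
    rw [map_zpow₀, genInv_genZ_eq, if_pos rfl, _root_.inv_zpow', ← zpow_add₀ (genZ_ne_zero _), add_neg_cancel, zpow_zero]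
  rw [ht] at h
  exact h

/-- The down phase. [cite: IkhlefPonsaing2012, (20)–(22)] -/
theorem cocRelE_down (hex : ∀ i, 1 ≤ i → i ≤ 2 * m → ∀ s, genSwap ℂ i (v s) = (v ᵥ* eR Ec q i (genZ ℂ i) (genZ ℂ (i + 1))) s)
    (hbot : ∀ s, genInv ℂ 1 (v s) = genZ ℂ 1 ^ (2 * a) * v s)
    (htop : ∀ s, genInv ℂ (2 * m + 1) (v s) = genZ ℂ (2 * m + 1) ^ (2 * a) * v s) {j : ℕ} (hj : j ≤ 2 * m) :
    CocRelE v (downHom m j) (downBE Ec m q j) 1 := by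
  induction j with
  | zero => exact cocRelE_mid hex hbot htop
  | succ j ih =>
    have h := cocRelE_swap (ih (by omega)) (hex (2 * m - j) (by omega) (by omega))
    rw [map_one] at h
    exact h

/-- **Every solution is fixed by the cocycle matrix**: `v ᵥ* (Y - 1) = 0`. [cite: IkhlefPonsaing2012, §3.4 (20)–(22)] -/
theorem solutionE_vecMul_cocycleYE
    (hex : ∀ i, 1 ≤ i → i ≤ 2 * m → ∀ s, genSwap ℂ i (v s) = (v ᵥ* eR Ec q i (genZ ℂ i) (genZ ℂ (i + 1))) s)
    (hbot : ∀ s, genInv ℂ 1 (v s) = genZ ℂ 1 ^ (2 * a) * v s)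
    (htop : ∀ s, genInv ℂ (2 * m + 1) (v s) = genZ ℂ (2 * m + 1) ^ (2 * a) * v s) :
    v ᵥ* (cocycleYE Ec m q - 1) = 0 := by
  have h := cocRelE_down hex hbot htop (le_refl (2 * m))
  rw [downHom_two_mul_eq_id] at h
  funext s
  rw [vecMul_sub, vecMul_one, Pi.sub_apply, Pi.zero_apply, sub_eq_zero, cocycleYE]
  have := h s
  rw [RingHom.id_apply, one_mul] at this
  exact this.symm

end Cocycle

/-! ### The cocycle matrix as an explicit product -/

section ClosedForm

open _root_.Matrix

variable {α : Type*} [Fintype α] [DecidableEq α] (Ec : ℕ → Matrix α α ℂ) {m : ℕ}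

/-- The matrix of a descriptor. [folklore] -/
def dMatE (q : ℂ) (f : FDesc) : Matrix α α (RapidityField ℂ) := eR Ec q f.1 (toRF ℂ f.2.1) (toRF ℂ f.2.2)

/-- The ordered product of the matrices of a list of descriptors. [folklore] -/
def prodDE (q : ℂ) (l : List FDesc) : Matrix α α (RapidityField ℂ) := (l.map (dMatE Ec q)).prod

/-- `prodDE` of a cons. [folklore] -/
theorem prodDE_cons (q : ℂ) (f : FDesc) (l : List FDesc) : prodDE Ec q (f :: l) = dMatE Ec q f * prodDE Ec q l := by
  rw [prodDE, List.map_cons, List.prod_cons, prodDE]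

/-- `prodDE` of an append. [folklore] -/
theorem prodDE_append (q : ℂ) (l l' : List FDesc) : prodDE Ec q (l ++ l') = prodDE Ec q l * prodDE Ec q l' := by
  rw [prodDE, List.map_append, List.prod_append, prodDE, prodDE]

/-- Transporting a product of descriptor matrices along an endomorphism fixing the constants. [folklore] -/
theorem map_prodDE {φ : RapidityField ℂ →+* RapidityField ℂ} (hφ : ∀ a, φ (genC ℂ a) = genC ℂ a) (q : ℂ) (l : List FDesc) :
    (prodDE Ec q l).map φ = (l.map fun f => eR Ec q f.1 (φ (toRF ℂ f.2.1)) (φ (toRF ℂ f.2.2))).prod := by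
  induction l with
  | nil => rw [prodDE, List.map_nil, List.map_nil, List.prod_nil, Matrix.map_one _ (map_zero φ) (map_one φ)]
  | cons f l ih =>
    rw [prodDE_cons, Matrix.map_mul, ih, List.map_cons, List.prod_cons, dMatE, map_eR hφ]

/-- Transport along `σ_k` renames the descriptors. [folklore] -/
theorem map_prodDE_genSwap (q : ℂ) (k : ℕ) (l : List FDesc) : (prodDE Ec q l).map (genSwap ℂ k) = prodDE Ec q (l.map (dSwap k)) := by
  have h := map_prodDE Ec (φ := (genSwap ℂ k).toRingHom) (fun a => by simp [genSwap_genC]) q l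
  simp only [RingEquiv.toRingHom_eq_coe, RingHom.coe_coe, genSwap_toRF] at h
  rw [h, prodDE, List.map_map]
  rfl

/-- **Closed form of the up phase.** [folklore] -/
theorem upBE_eq_prodDE (q : ℂ) (k : ℕ) : upBE Ec m q k = prodDE Ec q (upList k) := by
  induction k with
  | zero => rw [upBE, upList, List.range_zero, List.reverse_nil, List.map_nil, prodDE, List.map_nil, List.prod_nil]
  | succ k ih =>
    rw [upBE, ih, map_prodDE_genSwap]
    have hl : (upList k).map (dSwap (k + 1)) = (List.range k).reverse.map fun i => (i + 1, X (i + 1), X (k + 2)) := by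
      rw [upList, List.map_map]
      refine List.map_congr_left fun i hi => ?_
      have hik : i < k := List.mem_range.1 (List.mem_reverse.1 hi)
      simp only [Function.comp_apply, dSwap, rename_X, Equiv.swap_apply_of_ne_of_ne (show i + 1 ≠ k + 1 by omega)
        (show i + 1 ≠ k + 1 + 1 by omega), Equiv.swap_apply_left]
    rw [hl, show upList (k + 1) = ((k + 1, X (k + 1), X (k + 2)) : FDesc) ::
        (List.range k).reverse.map (fun i => (i + 1, X (i + 1), X (k + 2))) from by
      rw [upList, List.range_succ, List.reverse_append, List.reverse_singleton, List.singleton_append, List.map_cons],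
      prodDE_cons]
    rfl

/-- **Closed form after the inversion at the top.** [folklore] -/
theorem downBE_zero_eq_prodDE (q : ℂ) : downBE Ec m q 0 = prodDE Ec q (midList m) := by
  rw [downBE, upBE_eq_prodDE, map_prodDE Ec (φ := genInv ℂ (2 * m + 1)) (genInv_genC _), midList, upList, List.map_map, prodDE,
    List.map_map]
  congr 1
  refine List.map_congr_left fun i hi => ?_
  have hi' : i < 2 * m := List.mem_range.1 (List.mem_reverse.1 hi)
  simp only [Function.comp_apply, dMatE]
  change eR Ec q (i + 1) (genInv ℂ (2 * m + 1) (genZ ℂ (i + 1))) (genInv ℂ (2 * m + 1) (genZ ℂ (2 * m + 1))) =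
    eR Ec q (i + 1) (toRF ℂ (X (i + 1) * X (2 * m + 1))) (toRF ℂ 1)
  rw [genInv_genZ_eq, if_neg (by omega), genInv_genZ_eq, if_pos rfl, map_mul, map_one]
  change _ = eR Ec q (i + 1) (genZ ℂ (i + 1) * genZ ℂ (2 * m + 1)) 1
  rw [eR, eR, ← RfMatE_scale (genC ℂ q) (genZ_ne_zero (2 * m + 1)), mul_inv_cancel₀ (genZ_ne_zero _), mul_comm]

/-- **Closed form of the down phase.** [folklore] -/
theorem downBE_eq_prodDE (q : ℂ) {j : ℕ} (hj : j ≤ 2 * m) : downBE Ec m q j = prodDE Ec q (ratioList m j ++ prodList m j) := by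
  induction j with
  | zero => rw [downBE_zero_eq_prodDE, ratioList, List.range_zero, List.map_nil, List.nil_append, prodList]
  | succ j ih =>
    rw [downBE, ih (by omega), map_prodDE_genSwap, List.map_append, prodDE_append, ← Matrix.mul_assoc, ← prodList, prodDE_append]
    congr 1
    have hl : (ratioList m j).map (dSwap (2 * m - j)) =
        (List.range j).map fun t => (2 * m - j + t + 1, X (2 * m - j), X (2 * m - j + t + 2)) := by
      rw [ratioList, List.map_map]
      refine List.map_congr_left fun t ht => ?_
      have htj : t < j := List.mem_range.1 ht
      simp only [Function.comp_apply, dSwap, rename_X]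
      rw [show 2 * m + 1 - j = 2 * m - j + 1 by omega, Equiv.swap_apply_right,
        Equiv.swap_apply_of_ne_of_ne (show 2 * m - j + 1 + t + 1 ≠ 2 * m - j by omega)
          (show 2 * m - j + 1 + t + 1 ≠ 2 * m - j + 1 by omega)]
      refine Prod.ext (by simp only; omega) (Prod.ext rfl ?_)
      simp only
      congr 1; omega
    rw [hl, show ratioList m (j + 1) = ((2 * m - j, X (2 * m - j), X (2 * m - j + 1)) : FDesc) ::
        (List.range j).map (fun t => (2 * m - j + t + 1, X (2 * m - j), X (2 * m - j + t + 2))) from by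
      rw [ratioList, List.range_succ_eq_map, List.map_cons, List.map_map]
      refine congrArg₂ _ ?_ (List.map_congr_left fun t _ => ?_)
      · refine Prod.ext (by simp only; omega) (Prod.ext ?_ ?_) <;> simp only <;> congr 1 <;> omega
      · simp only [Function.comp_apply]
        refine Prod.ext (by simp only; omega) (Prod.ext ?_ ?_) <;> simp only <;> congr 1 <;> omega,
      prodDE_cons]
    rfl

/-- **The cocycle matrix is the product over `finalList`.** [folklore] -/
theorem cocycleYE_eq_prodDE (q : ℂ) : cocycleYE Ec m q = prodDE Ec q (finalList m) := by
  rw [cocycleYE, downBE_eq_prodDE Ec q le_rfl, ratioList, finalList]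
  congr 3
  funext t
  refine Prod.ext (by simp only; omega) (Prod.ext ?_ ?_) <;> simp only <;> congr 1 <;> omega

end ClosedForm

/-! ### Evaluation at the special point -/

section SpecialPoint

open _root_.Matrix

variable {α : Type*} [Fintype α] [DecidableEq α] (Ec : ℕ → Matrix α α ℂ) {m : ℕ}

/-- The polynomial matrix of a descriptor (cleared denominators). [folklore] -/
def RpOfE (q : ℂ) (f : FDesc) : Matrix α α (MvPolynomial ℕ ℂ) := RpMatE (C q) f.2.1 f.2.2 ((Ec f.1).map C)

/-- **Specialising a product of cleared factors.** [folklore] -/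
theorem map_prod_RpOfE {K : Type*} [Field K] (φ : MvPolynomial ℕ ℂ →+* K) (q : ℂ) (l : List FDesc) (hl : ∀ f ∈ l, φ (cPoly q f) ≠ 0) :
    ((l.map (RpOfE Ec q)).prod).map φ =
      φ ((l.map (cPoly q)).prod) • (l.map fun f => RfMatE (φ (C q)) (φ f.2.1) (φ f.2.2) ((Ec f.1).map (φ ∘ C))).prod := by
  induction l with
  | nil => rw [List.map_nil, List.prod_nil, List.map_nil, List.prod_nil, map_one, one_smul, List.map_nil, List.prod_nil,
      Matrix.map_one _ (map_zero φ) (map_one φ)]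
  | cons f l ih =>
    have hf : φ (cPoly q f) ≠ 0 := hl f (by simp)
    rw [List.map_cons, List.prod_cons, Matrix.map_mul, ih (fun g hg => hl g (List.mem_cons_of_mem _ hg)), List.map_cons, List.prod_cons,
      map_mul, List.map_cons, List.prod_cons, RpOfE, map_RpMatE, Matrix.map_map]
    have hR : RpMatE (φ (C q)) (φ f.2.1) (φ f.2.2) ((Ec f.1).map (φ ∘ C)) =
        φ (cPoly q f) • RfMatE (φ (C q)) (φ f.2.1) (φ f.2.2) ((Ec f.1).map (φ ∘ C)) := by
      rw [RfMatE, smul_smul]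
      have : φ (cPoly q f) * (φ (C q) ^ 2 * φ f.2.1 ^ 2 - φ f.2.2 ^ 2)⁻¹ = 1 := by
        rw [cPoly, map_sub, map_mul, map_pow, map_pow, map_pow] at hf ⊢
        exact mul_inv_cancel₀ hf
      rw [this, one_smul]
    rw [hR, Matrix.smul_mul, Matrix.mul_smul, smul_smul]

variable {q : ℂ}

omit [Fintype α] in
/-- The evaluated ratio factor at an odd level is the generator. [folklore] -/
theorem RfMatE_ratio_even (hq : q ^ 2 + q + 1 = 0) (E : Matrix α α ℂ) : RfMatE q 2 (2 * q ^ 2) E = E := by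
  have hq0 := ne_zero_of_quad hq
  have ha : q ^ 2 * (2 * q ^ 2) ^ 2 - (2 : ℂ) ^ 2 = 0 := by linear_combination 4 * (q - 1) * (q ^ 3 + 1) * hq
  have hcb : q ^ 2 * (2 : ℂ) ^ 2 - (2 * q ^ 2) ^ 2 = -(q * ((2 : ℂ) ^ 2 - (2 * q ^ 2) ^ 2)) := by
    linear_combination (-4 * q * (q + 1) * (q - 1)) * hq
  have hc : q ^ 2 * (2 : ℂ) ^ 2 - (2 * q ^ 2) ^ 2 ≠ 0 := by
    rw [show q ^ 2 * (2 : ℂ) ^ 2 - (2 * q ^ 2) ^ 2 = 4 * q ^ 2 * (1 - q ^ 2) by ring]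
    exact mul_ne_zero (mul_ne_zero (by norm_num) (pow_ne_zero 2 hq0)) (sub_ne_zero.2 (sq_ne_one_of_quad hq (by norm_num)).symm)
  rw [RfMatE, RpMatE, ha, zero_smul, zero_sub, ← neg_smul, ← hcb, inv_smul_smul₀ hc]

omit [Fintype α] in
/-- The evaluated ratio factor at an even level is the identity. [folklore] -/
theorem RfMatE_ratio_odd (hq : q ^ 2 + q + 1 = 0) (E : Matrix α α ℂ) : RfMatE q 2 2 E = 1 := by
  have hc : q ^ 2 * (2 : ℂ) ^ 2 - (2 : ℂ) ^ 2 ≠ 0 := by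
    rw [show q ^ 2 * (2 : ℂ) ^ 2 - 2 ^ 2 = 4 * (q ^ 2 - 1) by ring]
    exact mul_ne_zero (by norm_num) (sub_ne_zero.2 (sq_ne_one_of_quad hq (by norm_num)))
  rw [RfMatE, RpMatE, sub_self, mul_zero, zero_smul, sub_zero, inv_smul_smul₀ hc]

/-- The product of the generators at the odd levels `E_1 E_3 ⋯ E_{2m-1}` (with identities interleaved). [folklore] -/
def oddProdE (m : ℕ) : Matrix α α ℂ := ((List.range (2 * m)).map fun t => if t % 2 = 0 then Ec (t + 1) else 1).prod

/-- **The evaluated ratio factors multiply to `E_1 E_3 ⋯ E_{2m-1}`.** [folklore] -/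
theorem prod_ratio_evalE (hq : q ^ 2 + q + 1 = 0) :
    (((List.range (2 * m)).map fun t => ((t + 1, X 1, X (t + 2)) : FDesc)).map fun f =>
        RfMatE (eval (ipt' q) (C q)) (eval (ipt' q) f.2.1) (eval (ipt' q) f.2.2) ((Ec f.1).map (eval (ipt' q) ∘ C))).prod =
      oddProdE Ec m := by
  rw [List.map_map, oddProdE]
  congr 1
  refine List.map_congr_left fun t _ => ?_
  simp only [Function.comp_apply, eval_C, eval_X]
  have hE : (Ec (t + 1)).map (eval (ipt' q) ∘ C) = Ec (t + 1) := by
    ext s s'; simp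
  have h1 : ipt' q 1 = 2 := by simp [ipt']
  rw [h1, hE]
  rcases Nat.mod_two_eq_zero_or_one t with ht | ht
  · have h2 : ipt' q (t + 2) = 2 * q ^ 2 := by simp [ipt', ht]
    rw [h2, RfMatE_ratio_even hq, if_pos ht]
  · have h2 : ipt' q (t + 2) = 2 := by simp [ipt', ht]
    rw [h2, RfMatE_ratio_odd hq, if_neg (by omega)]

/-- **The left kernel of `P S - 1` is a line** when `x ᵥ* P` always lies on the line of `w₀`. [folklore] -/
theorem vecMul_rankOne_line {P S : Matrix α α ℂ} {w₀ : α → ℂ} (hP : ∀ x : α → ℂ, ∃ a : ℂ, x ᵥ* P = a • w₀) (x : α → ℂ)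
    (hx : x ᵥ* (P * S - 1) = 0) : ∃ a : ℂ, x = a • (w₀ ᵥ* S) := by
  obtain ⟨a, ha⟩ := hP x
  refine ⟨a, ?_⟩
  have h : x ᵥ* (P * S) = x := by rw [vecMul_sub, vecMul_one, sub_eq_zero] at hx; exact hx
  conv_lhs => rw [← h]
  rw [← Matrix.vecMul_vecMul, ha, Matrix.smul_vecMul]

/-- **The adjugate of `Y - 1` is not zero** when `E_1 E_3 ⋯ E_{2m-1}` has rank one. [cite: IkhlefPonsaing2012, §3.4] -/
theorem adjugate_cocycleYE_sub_one_ne_zero (hq : q ^ 2 + q + 1 = 0) {w₀ : α → ℂ} (hP : ∀ x : α → ℂ, ∃ a : ℂ, x ᵥ* oddProdE Ec m = a • w₀)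
    (s₀ : α) : adjugate (cocycleYE Ec m q - 1) ≠ 0 := by
  have hY : cocycleYE Ec m q = prodDE Ec q (finalList m) := cocycleYE_eq_prodDE Ec q
  set l := finalList m with hl
  set Mp : Matrix α α (MvPolynomial ℕ ℂ) := (l.map (RpOfE Ec q)).prod with hMp
  set cp : MvPolynomial ℕ ℂ := (l.map (cPoly q)).prod with hcp
  have hne : ∀ f ∈ l, eval (ipt' q) (cPoly q f) ≠ 0 := eval_cPoly_ne_zero hq
  have hneRF : ∀ f ∈ l, toRF ℂ (cPoly q f) ≠ 0 := fun f hf => toRF_ne_zero_of_eval _ (hne f hf)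
  -- over the rapidity field: `Mp ↦ cp • Y`
  have h1 : Mp.map (toRF ℂ) = toRF ℂ cp • cocycleYE Ec m q := by
    rw [hMp, map_prod_RpOfE Ec (toRF ℂ) q l hneRF, hY, prodDE]
    rfl
  -- at the special point: `Mp ↦ cp(z⁰) • (P * S)`
  set S : Matrix α α ℂ := ((prodList m (2 * m)).map fun f =>
    RfMatE (eval (ipt' q) (C q)) (eval (ipt' q) f.2.1) (eval (ipt' q) f.2.2) ((Ec f.1).map (eval (ipt' q) ∘ C))).prod with hS
  have h2 : Mp.map (eval (ipt' q)) = eval (ipt' q) cp • (oddProdE Ec m * S) := by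
    rw [hMp, map_prod_RpOfE Ec (eval (ipt' q)) q l hne]
    congr 1
    rw [hl, finalList, List.map_append, List.prod_append, prod_ratio_evalE Ec hq]
  have hcpC : eval (ipt' q) cp ≠ 0 := by
    rw [hcp, map_list_prod, List.map_map]
    refine List.prod_ne_zero fun h0 => ?_
    obtain ⟨f, hf, hf0⟩ := List.mem_map.1 h0
    exact hne f hf hf0
  intro h0
  have h3 : adjugate (Mp - cp • (1 : Matrix _ _ (MvPolynomial ℕ ℂ))) = 0 := by
    have h3' : (toRF ℂ).mapMatrix (adjugate (Mp - cp • 1)) = 0 := by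
      rw [RingHom.map_adjugate, RingHom.mapMatrix_apply, Matrix.map_sub _ (map_sub (toRF ℂ)), h1, map_smul_one, ← smul_sub,
        adjugate_smul, h0, smul_zero]
    refine Matrix.ext fun i j => ?_
    have := congrArg (fun M : Matrix _ _ (RapidityField ℂ) => M i j) h3'
    simp only [RingHom.mapMatrix_apply, Matrix.map_apply, Matrix.zero_apply] at this
    rw [Matrix.zero_apply]
    exact toRF_injective (by rw [this, map_zero])
  have h4 : adjugate (oddProdE Ec m * S - 1) = 0 := by
    have h4' : (eval (ipt' q)).mapMatrix (adjugate (Mp - cp • 1)) = 0 := by rw [h3, map_zero]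
    rw [RingHom.map_adjugate, RingHom.mapMatrix_apply, Matrix.map_sub _ (map_sub (eval (ipt' q))), h2, map_smul_one, ← smul_sub,
      adjugate_smul, smul_eq_zero] at h4'
    rcases h4' with h | h
    · exact absurd h (pow_ne_zero _ hcpC)
    · exact h
  exact Literature.LinearAlgebra.Matrix.adjugate_ne_zero_of_vecMul_line _ _ (vecMul_rankOne_line hP) s₀ h4

end SpecialPoint

/-! ### Conclusion -/

section Conclusion

open _root_.Matrix Literature.LinearAlgebra.Matrix

variable {α : Type*} [Fintype α] [DecidableEq α] {Ec : ℕ → Matrix α α ℂ} {m : ℕ}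

/-- **Uniqueness of the exact boundary qKZ solution for a constant representation whose odd generator
product has rank one**: any two solutions (all bulk levels, both reflections with the same monomial
twist) are proportional over the rapidity field. [cite: IkhlefPonsaing2012, §3.4 (20)–(22)] -/
theorem solutionsE_proportional {q : ℂ} (hq : q ^ 2 + q + 1 = 0) {w₀ : α → ℂ}
    (hP : ∀ x : α → ℂ, ∃ a : ℂ, x ᵥ* oddProdE Ec m = a • w₀) {v v' : α → RapidityField ℂ} {a : ℤ}
    (hex : ∀ i, 1 ≤ i → i ≤ 2 * m → ∀ s, genSwap ℂ i (v s) = (v ᵥ* eR Ec q i (genZ ℂ i) (genZ ℂ (i + 1))) s)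
    (hbot : ∀ s, genInv ℂ 1 (v s) = genZ ℂ 1 ^ (2 * a) * v s)
    (htop : ∀ s, genInv ℂ (2 * m + 1) (v s) = genZ ℂ (2 * m + 1) ^ (2 * a) * v s)
    (hex' : ∀ i, 1 ≤ i → i ≤ 2 * m → ∀ s, genSwap ℂ i (v' s) = (v' ᵥ* eR Ec q i (genZ ℂ i) (genZ ℂ (i + 1))) s)
    (hbot' : ∀ s, genInv ℂ 1 (v' s) = genZ ℂ 1 ^ (2 * a) * v' s)
    (htop' : ∀ s, genInv ℂ (2 * m + 1) (v' s) = genZ ℂ (2 * m + 1) ^ (2 * a) * v' s) (k : α) :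
    v' k • v = v k • v' :=
  vecMul_proportional_of_adjugate_ne_zero _ (adjugate_cocycleYE_sub_one_ne_zero Ec hq hP k)
    (solutionE_vecMul_cocycleYE hex hbot htop) (solutionE_vecMul_cocycleYE hex' hbot' htop') k

end Conclusion

end Literature.Probability.Percolation
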